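import Mathlib
import Summits.Ventures.PercRepro2.Defs
import Summits.Ventures.PercRepro2.Harris
import Summits.Ventures.PercRepro2.Graph
import Summits.Ventures.PercRepro2.Events
import Summits.Ventures.PercRepro2.Induced
import Summits.Ventures.PercRepro2.BHKAvoid
import Summits.Ventures.PercRepro2.CCTRootEdge
import Summits.Ventures.PercRepro2.CCTAvoidedEdge
import Summits.Ventures.PercRepro2.OneRootDropMono

/-!
# The avoided-set monotonicity theorem `AvoidMono.avoid_mono`
(blind cell PercRepro2, mine-c g30; `conjectures/MINE-C.md` §39.2)

A root `a₂`, a finite set `S` of vertices with `a₁, v ∈ S`, an edge `e = {v, y}` at `v` of weight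
`t`, and an up-set `𝓥` of vertex sets.  The conditional probability

  `P_t(C(a₁) ∈ 𝓥 | a₂ ↮ S) = P_t(C(a₁) ∈ 𝓥, a₂ ↮ S) / P_t(a₂ ↮ S)`

is non-decreasing in `t`: connections of `a₁` (which `a₂` avoids) grow with every edge at an
avoided vertex.  Proof: condition on the status of `e`.  With `e` open, `a₂ ↮ S` holds iff (with
`e` closed) `a₂ ↮ S` and `a₂ ↮ y` (`v ∈ S`), and `C(a₁)` can only grow; BHK06 Thm 1.4 with the
avoided set `S ∋ a₁` (`bhk_cross_cluster_avoid`) says that the extra condition `y ∉ C(a₂)` raises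
`P(C(a₁) ∈ 𝓥)`; the conditional probability at `t` is the mediant of the `e`-closed and `e`-open
values with the weight on the second growing with `t`.  Corollaries with `S = {a₁, v}`:
`P(a₁ ↔ b, a₁ ↔ v | a₂ ↮ {a₁, v})` grows (`conn_pair_mono`), and so does the ratio
`P(a₁ ↔ b, a₁ ↔ v, a₁ ↮ a₂) / P(a₁, a₂, v pairwise disconnected)` (`conn_pair_free_mono`).
-/

namespace Summit.Ventures.PercRepro2

namespace AvoidMono

variable {V : Type*} {E : Type*} [Fintype V] [DecidableEq V] [Fintype E] [DecidableEq E]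
  {R : Type*} [Field R] [LinearOrder R] [IsStrictOrderedRing R]

section Pinned

variable {ends : E → Sym2 V} {e : E} {v y : V}

omit [Fintype V] [DecidableEq V] [Fintype E] in
/-- With `e = {v, y}` open and `v ∈ S`, `a ↮ S` iff (with `e` closed) `a ↮ S` and `a ↮ y`. -/
lemma update_true_mem_avoidAll_iff (hends : ends e = s(v, y)) (ω : Config E) (a : V)
    {S : Finset V} (hv : v ∈ S) :
    Function.update ω e true ∈ avoidAll ends a S ↔
      Function.update ω e false ∈ avoidAll ends a S ∧
        Function.update ω e false ∈ avoidAll ends a {y} := by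
  have hcl := CCT.cluster_update_true_eq hends ω
  constructor
  · intro h
    have hv' : ¬ Conn ends (Function.update ω e true) a v := h v hv
    refine ⟨fun x hx hc => h x hx (conn_mono (update_false_le_update_true ω e) hc), ?_⟩
    rw [mem_avoidAll]
    intro x hx
    rw [Finset.mem_singleton] at hx
    subst hx
    intro hc
    apply hv'
    have h1 : Conn ends (Function.update ω e true) a x :=
      conn_mono (update_false_le_update_true ω e) hc
    have h2 : x ∈ cluster ends (Function.update ω e true) v := by
      rw [hcl]
      exact Or.inr (mem_cluster_self _ _ _)
    rw [mem_cluster] at h2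
    exact conn_trans h1 (conn_symm h2)
  · rintro ⟨hS, hy⟩
    have hvn : v ∉ cluster ends (Function.update ω e false) a := by
      rw [mem_cluster]; exact hS v hv
    have hyn : y ∉ cluster ends (Function.update ω e false) a := by
      rw [mem_cluster]; exact hy y (Finset.mem_singleton_self y)
    have hcla := CCT.cluster_update_true_eq_of_not_touch ends hends ω a hvn hyn
    intro x hx hc
    apply hS x hx
    rw [← mem_cluster, ← hcla, mem_cluster]
    exact hc

variable (p : E → R)

omit [Fintype V] [DecidableEq V] [LinearOrder R] [IsStrictOrderedRing R] in
/-- `P₁(a ↮ S) = P₀(a ↮ S, a ↮ y)` for `v ∈ S`. -/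
lemma prob_one_avoidAll (hends : ends e = s(v, y)) (a : V) {S : Finset V} (hv : v ∈ S) :
    prob (Function.update p e 1) (avoidAll ends a S) =
      prob (Function.update p e 0) (avoidAll ends a S ∩ avoidAll ends a {y}) := by
  rw [CCT.prob_update_one_eq, CCT.prob_update_zero_eq]
  congr 1
  ext ω
  simp only [Set.mem_setOf_eq, Set.mem_inter_iff]
  exact update_true_mem_avoidAll_iff hends ω a hv

omit [Fintype V] [DecidableEq V] in
/-- `P₀(C(a₁) ∈ 𝓥, a₂ ↮ S, a₂ ↮ y) ≤ P₁(C(a₁) ∈ 𝓥, a₂ ↮ S)`: opening `e` keeps the avoidance and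
can only enlarge `C(a₁)`. -/
lemma prob_zero_le_prob_one (hp : IsProbVec p) (hends : ends e = s(v, y)) (a₁ a₂ : V)
    {S : Finset V} (hv : v ∈ S) {𝓥 : Set (Set V)} (h𝓥 : IsUpperSet 𝓥) :
    prob (Function.update p e 0)
        (clusterInEvent ends a₁ 𝓥 ∩ avoidAll ends a₂ S ∩ avoidAll ends a₂ {y}) ≤
      prob (Function.update p e 1) (clusterInEvent ends a₁ 𝓥 ∩ avoidAll ends a₂ S) := by
  rw [CCT.prob_update_one_eq, CCT.prob_update_zero_eq]
  refine prob_mono hp fun ω hω => ?_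
  simp only [Set.mem_setOf_eq, Set.mem_inter_iff] at hω ⊢
  refine ⟨?_, (update_true_mem_avoidAll_iff hends ω a₂ hv).2 ⟨hω.1.2, hω.2⟩⟩
  rw [mem_clusterInEvent] at hω ⊢
  exact h𝓥 (cluster_mono (update_false_le_update_true ω e) a₁) hω.1.1

end Pinned

section BHK

variable (p : E → R) (ends : E → Sym2 V)

omit [Fintype V] [DecidableEq V] [Fintype E] [DecidableEq E] in
/-- `{a ↮ y} = {a ↔ y}ᶜ`. -/
lemma avoid_singleton_eq_compl (a y : V) : avoidAll ends a {y} = (connEvent ends a y)ᶜ := by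
  ext ω
  simp only [avoidAll, Set.mem_setOf_eq, Finset.mem_singleton, forall_eq, Set.mem_compl_iff,
    mem_connEvent]

/-- **BHK06 1.4 with `S ∋ a₁` avoided by `a₂`, complement form**: for an up-set `𝓥`,
`P(C(a₁) ∈ 𝓥, a₂ ↮ S) · P(a₂ ↮ S, a₂ ↮ y) ≤ P(C(a₁) ∈ 𝓥, a₂ ↮ S, a₂ ↮ y) · P(a₂ ↮ S)`. -/
lemma bhk14_avoid_complement (hp : IsProbVec p) (a₁ a₂ y : V) {S : Finset V} (ha₁ : a₁ ∈ S)
    {𝓥 : Set (Set V)} (h𝓥 : IsUpperSet 𝓥) :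
    prob p (clusterInEvent ends a₁ 𝓥 ∩ avoidAll ends a₂ S) *
        prob p (avoidAll ends a₂ S ∩ avoidAll ends a₂ {y}) ≤
      prob p (clusterInEvent ends a₁ 𝓥 ∩ avoidAll ends a₂ S ∩ avoidAll ends a₂ {y}) *
        prob p (avoidAll ends a₂ S) := by
  have hU : IsUpperSet {L : Set V | y ∈ L} := fun _ _ hST h => hST h
  have key := bhk_cross_cluster_avoid p hp ends a₂ a₁ (X := S) ha₁ hU h𝓥
  have e1 : clusterInEvent ends a₂ {L : Set V | y ∈ L} = connEvent ends a₂ y := by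
    ext ω; simp only [mem_clusterInEvent, Set.mem_setOf_eq, mem_cluster, mem_connEvent]
  rw [e1] at key
  rw [avoid_singleton_eq_compl]
  set Ω := avoidAll ends a₂ S with hΩ
  set F := clusterInEvent ends a₁ 𝓥 with hF
  set Y := connEvent ends a₂ y with hY
  have s1 := prob_inter_add_prob_inter_compl p (F ∩ Ω) Y
  have s2 := prob_inter_add_prob_inter_compl p Ω Y
  have k1 : Y ∩ F ∩ Ω = F ∩ Ω ∩ Y := by
    ext ω; simp only [Set.mem_inter_iff]; tauto
  have k2 : Y ∩ Ω = Ω ∩ Y := Set.inter_comm _ _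
  rw [k1, k2] at key
  nlinarith [key, s1, s2, prob_nonneg hp (F ∩ Ω), prob_nonneg hp Ω, prob_nonneg hp (F ∩ Ω ∩ Y),
    prob_nonneg hp (Ω ∩ Y), prob_nonneg hp (F ∩ Ω ∩ Yᶜ), prob_nonneg hp (Ω ∩ Yᶜ)]

end BHK

section Main

variable (p : E → R) (ends : E → Sym2 V) {e : E} {v y : V}

/-- **The avoided-set monotonicity theorem**: for `a₁, v ∈ S`, an edge `e = {v, y}` and an up-set
`𝓥`, `P_t(C(a₁) ∈ 𝓥 | a₂ ↮ S)` is non-decreasing in the weight `t` of `e` (for `s ≤ t`, wherever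
both conditioning probabilities are positive). -/
theorem avoid_mono (hp : IsProbVec p) (hends : ends e = s(v, y)) (a₁ a₂ : V) {S : Finset V}
    (ha₁ : a₁ ∈ S) (hv : v ∈ S) {𝓥 : Set (Set V)} (h𝓥 : IsUpperSet 𝓥) {s t : R} (hst : s ≤ t)
    (hs : 0 < prob (Function.update p e s) (avoidAll ends a₂ S))
    (ht : 0 < prob (Function.update p e t) (avoidAll ends a₂ S)) :
    prob (Function.update p e s) (clusterInEvent ends a₁ 𝓥 ∩ avoidAll ends a₂ S) /
        prob (Function.update p e s) (avoidAll ends a₂ S) ≤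
      prob (Function.update p e t) (clusterInEvent ends a₁ 𝓥 ∩ avoidAll ends a₂ S) /
        prob (Function.update p e t) (avoidAll ends a₂ S) := by
  have hp₀ : IsProbVec (Function.update p e 0) := hp.update e le_rfl zero_le_one
  have h1 := prob_one_avoidAll p hends a₂ hv
  have h3 := prob_zero_le_prob_one p hp hends a₁ a₂ hv h𝓥
  have hb := bhk14_avoid_complement (Function.update p e 0) ends hp₀ a₁ a₂ y ha₁ h𝓥
  have hD0 := prob_nonneg hp₀ (avoidAll ends a₂ S)
  rw [OneRootDrop.prob_update_eq_pin p s (clusterInEvent ends a₁ 𝓥 ∩ avoidAll ends a₂ S),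
    OneRootDrop.prob_update_eq_pin p s (avoidAll ends a₂ S),
    OneRootDrop.prob_update_eq_pin p t (clusterInEvent ends a₁ 𝓥 ∩ avoidAll ends a₂ S),
    OneRootDrop.prob_update_eq_pin p t (avoidAll ends a₂ S), h1]
  rw [OneRootDrop.prob_update_eq_pin p s (avoidAll ends a₂ S), h1] at hs
  rw [OneRootDrop.prob_update_eq_pin p t (avoidAll ends a₂ S), h1] at ht
  rw [div_le_div_iff₀ hs ht]
  generalize hN1 : prob (Function.update p e 1)
    (clusterInEvent ends a₁ 𝓥 ∩ avoidAll ends a₂ S) = N₁ at *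
  generalize hN0 : prob (Function.update p e 0)
    (clusterInEvent ends a₁ 𝓥 ∩ avoidAll ends a₂ S) = N₀ at *
  generalize hN0' : prob (Function.update p e 0)
    (clusterInEvent ends a₁ 𝓥 ∩ avoidAll ends a₂ S ∩ avoidAll ends a₂ {y}) = N₀' at *
  generalize hD1 : prob (Function.update p e 0) (avoidAll ends a₂ S ∩ avoidAll ends a₂ {y}) = D₁
    at *
  generalize hD0' : prob (Function.update p e 0) (avoidAll ends a₂ S) = D₀ at *
  have hkey : N₀ * D₁ ≤ N₁ * D₀ := le_trans hb (mul_le_mul_of_nonneg_right h3 hD0)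
  have hid : (t * N₁ + (1 - t) * N₀) * (s * D₁ + (1 - s) * D₀) -
      (s * N₁ + (1 - s) * N₀) * (t * D₁ + (1 - t) * D₀) = (t - s) * (N₁ * D₀ - N₀ * D₁) := by
    ring
  nlinarith [hid, mul_nonneg (sub_nonneg.2 hst) (sub_nonneg.2 hkey)]

omit [Fintype V] [DecidableEq V] [Fintype E] [DecidableEq E] in
/-- The up-set `{K | b ∈ K ∧ v ∈ K}` gives the event `{a₁ ↔ b} ∩ {a₁ ↔ v}`. -/
lemma clusterInEvent_pair (a₁ b v : V) :
    clusterInEvent ends a₁ {K : Set V | b ∈ K ∧ v ∈ K} = connEvent ends a₁ b ∩ connEvent ends a₁ v := by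
  ext ω
  simp only [mem_clusterInEvent, Set.mem_setOf_eq, mem_cluster, Set.mem_inter_iff, mem_connEvent]

/-- **Corollary**: `P_t(a₁ ↔ b, a₁ ↔ v | a₂ ↮ {a₁, v})` is non-decreasing in the weight of an edge
`e = {v, y}` at `v`. -/
theorem conn_pair_mono (hp : IsProbVec p) (hends : ends e = s(v, y)) (a₁ a₂ b : V) {s t : R}
    (hst : s ≤ t) (hs : 0 < prob (Function.update p e s) (avoidAll ends a₂ {a₁, v}))
    (ht : 0 < prob (Function.update p e t) (avoidAll ends a₂ {a₁, v})) :
    prob (Function.update p e s)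
        (connEvent ends a₁ b ∩ connEvent ends a₁ v ∩ avoidAll ends a₂ {a₁, v}) /
        prob (Function.update p e s) (avoidAll ends a₂ {a₁, v}) ≤
      prob (Function.update p e t)
        (connEvent ends a₁ b ∩ connEvent ends a₁ v ∩ avoidAll ends a₂ {a₁, v}) /
        prob (Function.update p e t) (avoidAll ends a₂ {a₁, v}) := by
  have h𝓥 : IsUpperSet {K : Set V | b ∈ K ∧ v ∈ K} := fun _ _ hST h => ⟨hST h.1, hST h.2⟩
  have := avoid_mono p ends hp hends a₁ a₂ (S := {a₁, v}) (Finset.mem_insert_self a₁ {v})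
    (Finset.mem_insert_of_mem (Finset.mem_singleton_self v)) h𝓥 hst hs ht
  rwa [clusterInEvent_pair] at this

omit [Fintype V] [DecidableEq V] [Fintype E] [DecidableEq E] in
/-- The up-set `{K | v ∈ K}` gives the event `{a₁ ↔ v}`. -/
lemma clusterInEvent_single (a₁ v : V) :
    clusterInEvent ends a₁ {K : Set V | v ∈ K} = connEvent ends a₁ v := by
  ext ω
  simp only [mem_clusterInEvent, Set.mem_setOf_eq, mem_cluster, mem_connEvent]

omit [Fintype V] [LinearOrder R] [IsStrictOrderedRing R] in
/-- `P(a₂ ↮ {a₁, v}) = P(a₁ ↔ v, a₂ ↮ {a₁, v}) + P(a₁ ↮ v, a₂ ↮ {a₁, v})`. -/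
lemma prob_avoid_split (a₁ a₂ v : V) :
    prob p (avoidAll ends a₂ {a₁, v}) =
      prob p (connEvent ends a₁ v ∩ avoidAll ends a₂ {a₁, v}) +
        prob p (avoidAll ends a₂ {a₁, v} ∩ avoidAll ends a₁ {v}) := by
  have h := prob_inter_add_prob_inter_compl p (avoidAll ends a₂ {a₁, v}) (connEvent ends a₁ v)
  rw [← h, Set.inter_comm, avoid_singleton_eq_compl]

/-- **Corollary**: the ratio `P_t(a₁ ↔ b, a₁ ↔ v, a₂ ↮ {a₁, v}) / P_t(a₂ ↮ {a₁, v}, a₁ ↮ v)`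
(`= ν(b, v ∈ C₁)/ν(v ∉ C₁ ∪ C₂)` under `ν = P(· | a₁ ↮ a₂)`) is non-decreasing in the weight of
an edge `e = {v, y}` at `v`, wherever the denominators are positive. -/
theorem conn_pair_free_mono (hp : IsProbVec p) (hends : ends e = s(v, y)) (a₁ a₂ b : V) {s t : R}
    (hs0 : 0 ≤ s) (hst : s ≤ t) (ht1 : t ≤ 1)
    (hs : 0 < prob (Function.update p e s) (avoidAll ends a₂ {a₁, v} ∩ avoidAll ends a₁ {v}))
    (ht : 0 < prob (Function.update p e t) (avoidAll ends a₂ {a₁, v} ∩ avoidAll ends a₁ {v})) :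
    prob (Function.update p e s)
        (connEvent ends a₁ b ∩ connEvent ends a₁ v ∩ avoidAll ends a₂ {a₁, v}) /
        prob (Function.update p e s) (avoidAll ends a₂ {a₁, v} ∩ avoidAll ends a₁ {v}) ≤
      prob (Function.update p e t)
        (connEvent ends a₁ b ∩ connEvent ends a₁ v ∩ avoidAll ends a₂ {a₁, v}) /
        prob (Function.update p e t) (avoidAll ends a₂ {a₁, v} ∩ avoidAll ends a₁ {v}) := by
  have hps : IsProbVec (Function.update p e s) := hp.update e hs0 (le_trans hst ht1)
  have hpt : IsProbVec (Function.update p e t) := hp.update e (le_trans hs0 hst) ht1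
  have splits := prob_avoid_split (Function.update p e s) ends a₁ a₂ v
  have splitt := prob_avoid_split (Function.update p e t) ends a₁ a₂ v
  have hUs := prob_nonneg hps (connEvent ends a₁ v ∩ avoidAll ends a₂ {a₁, v})
  have hUt := prob_nonneg hpt (connEvent ends a₁ v ∩ avoidAll ends a₂ {a₁, v})
  have hNs := prob_nonneg hps
    (connEvent ends a₁ b ∩ connEvent ends a₁ v ∩ avoidAll ends a₂ {a₁, v})
  have hΩs : 0 < prob (Function.update p e s) (avoidAll ends a₂ {a₁, v}) := by
    rw [splits]; linarith
  have hΩt : 0 < prob (Function.update p e t) (avoidAll ends a₂ {a₁, v}) := by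
    rw [splitt]; linarith
  have hA := conn_pair_mono p ends hp hends a₁ a₂ b hst hΩs hΩt
  have h𝓥 : IsUpperSet {K : Set V | v ∈ K} := fun _ _ hST h => hST h
  have hB := avoid_mono p ends hp hends a₁ a₂ (S := {a₁, v}) (Finset.mem_insert_self a₁ {v})
    (Finset.mem_insert_of_mem (Finset.mem_singleton_self v)) h𝓥 hst hΩs hΩt
  rw [clusterInEvent_single] at hB
  rw [div_le_div_iff₀ hΩs hΩt] at hA hB
  rw [div_le_div_iff₀ hs ht]
  generalize hNs' : prob (Function.update p e s)
    (connEvent ends a₁ b ∩ connEvent ends a₁ v ∩ avoidAll ends a₂ {a₁, v}) = Ns at *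
  generalize hNt' : prob (Function.update p e t)
    (connEvent ends a₁ b ∩ connEvent ends a₁ v ∩ avoidAll ends a₂ {a₁, v}) = Nt at *
  generalize hUs' : prob (Function.update p e s)
    (connEvent ends a₁ v ∩ avoidAll ends a₂ {a₁, v}) = Us at *
  generalize hUt' : prob (Function.update p e t)
    (connEvent ends a₁ v ∩ avoidAll ends a₂ {a₁, v}) = Ut at *
  generalize hWs' : prob (Function.update p e s)
    (avoidAll ends a₂ {a₁, v} ∩ avoidAll ends a₁ {v}) = Ws at *
  generalize hWt' : prob (Function.update p e t)
    (avoidAll ends a₂ {a₁, v} ∩ avoidAll ends a₁ {v}) = Wt at *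
  generalize hDs' : prob (Function.update p e s) (avoidAll ends a₂ {a₁, v}) = Ds at *
  generalize hDt' : prob (Function.update p e t) (avoidAll ends a₂ {a₁, v}) = Dt at *
  subst splits splitt
  -- hA : Ns * (Ut + Wt) ≤ Nt * (Us + Ws);  hB : Us * (Ut + Wt) ≤ Ut * (Us + Ws);  goal : Ns * Wt ≤ Nt * Ws
  have h1 : Ns * Us * (Ut + Wt) ≤ Ns * Ut * (Us + Ws) := by
    have := mul_le_mul_of_nonneg_left hB hNs
    nlinarith [this]
  have h2 : Ns * (Ut + Wt) * Ws ≤ Nt * (Us + Ws) * Ws := mul_le_mul_of_nonneg_right hA hs.le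
  have h3 : (Us + Ws) * (Ns * Wt) ≤ (Us + Ws) * (Nt * Ws) := by nlinarith [h1, h2]
  exact le_of_mul_le_mul_left h3 hΩs

end Main

end AvoidMono

end Summit.Ventures.PercRepro2
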